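import Summits.ResolutionOfSingularities.ResolutionOfSingularities.Theorems.DualSandwich.Negative.NaiveDescentSetup

/-!
# Crux `DualSandwich` (stmt-ResolutionOfSingularities-17083) — NAIVE DESCENT IS FALSE:
# the trace of a regular model on the bottom of a height-one Frobenius sandwich is singular

Route `ResolutionOfSingularities/FoliationDescent`, crux #4 `DualSandwich := FolLU → LogCanQuotLU →
TorsorLUPerfect` (the double sandwich: Frobenius top `K ⊆ K₀^{1/p} ⊇ A₀^{1/p}`, then `n − 1`
purely inseparable DESCENTS of degree `p`, each consuming `FolLU`/`LogCanQuotLU` once — the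
registered line `birth` types one descent as `RelStep p`).

`naiveDescent_false` refutes the natural STRENGTHENING of the descent step in which no
modification is allowed: "in the situation of `RelStep` — `k` perfect of characteristic `p`,
`F ⊆ L` with `x ^ p ∈ F` for all `x ∈ L` and `L = F(y)` (height one, simple), `O` a valuation ring
of `L`, `B ⊆ O` a finitely generated model of `L` regular at the centre of `O` — the TRACE
`C = B ∩ F` is regular at the centre of `O ∩ F`". So the regular model of the bottom field that
`RelStep` asserts is NOT the trace of the regular top: the descent genuinely consumes a
modification (in the route: `FolLU` then `LogCanQuotLU`); equivalently, in `stub_relChain` the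
transport `A := B.comap _` is legitimate only in the base case `K = L`.

Witness (the `μ₂`-quotient surface singularity `A₁`, smallest possible: `p = 2`, dimension two):
`k = 𝔽₂`, `L = 𝔽₂(X₀, X₁)`, `B = 𝔽₂[X₀, X₁]` (a regular RING), `O` = order of vanishing at the
origin, `F = ker E` for the Euler derivation `E = X₀∂₀ + X₁∂₁` (so `F = 𝔽₂(X₀², X₀X₁)`,
`L = F(X₀)`, `L² ⊆ F`), `C = B ∩ F = 𝔽₂[X₀², X₀X₁, X₁²]` = `𝔽₂[u, v, w]/(w² − uv)`.
Proof that `C` is not regular at the centre `𝔮 = (u, v, w)`: elements of `𝔮` are EVEN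
polynomials without constant term, hence of order `≥ 2`, so `𝔮²` has order `≥ 4` and
`u = X₀²` (order 2) lies in `𝔪 ∖ 𝔪²` of `R = C_𝔮`; if `R` were regular, `R/(u)` would be regular
(Matsumura 14.2, tree `IsRegularLocalRing.quotient_span_singleton`), hence a domain (Matsumura
14.3, tree `isDomain_of_isRegularLocalRing`); but `w = X₀X₁` satisfies `w² = u · v ∈ (u)` while
`w ∉ (u)R` (`a X₀² = X₀X₁ s` forces `X₀ ∣ s`, i.e. `s ∈ 𝔮`). Infrastructure: the order valuation on
`𝔽₂[X₀,X₁]`, its extension to `L` and `B` f.g./regular/`Frac B = L` are REUSED from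
`Theorems/FolLU/Negative/SameModelSetup.lean`, `SameModel.lean` (crux `FolLU`, same route); the
Euler operator and the abstract regular-local-ring algebra are in `NaiveDescentSetup.lean`.
Definition-free, kernel-only, no facts. Refuter seat
refuter-cdisprove-stmt-ResolutionOfSingularities-17083-g2-0 (cdisprove gen 2), 2026-08-17.
-/

set_option linter.dupNamespace false

namespace Summit.ResolutionOfSingularities.ResolutionOfSingularities.Theorems

noncomputable section

open MvPolynomial WithZero IsLocalRing
open FolLUSameModelNeg

namespace DualSandwichNaiveDescentNeg

/-! ### The core: `𝔽₂[X₀², X₀X₁, X₁²]` is not regular at the origin -/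

section Core

variable (v₀ : Valuation (MvPolynomial (Fin 2) (ZMod 2)) ℤᵐ⁰)
  (hv : ∀ a : (MvPolynomial (Fin 2) (ZMod 2)), v₀ a = if a = 0 then 0 else exp (-((a : MvPowerSeries (Fin 2) (ZMod 2)).order.toNat : ℤ)))
  (v : Valuation (FractionRing (MvPolynomial (Fin 2) (ZMod 2))) ℤᵐ⁰)
  (hvK : ∀ a : (MvPolynomial (Fin 2) (ZMod 2)), v (algebraMap (MvPolynomial (Fin 2) (ZMod 2)) (FractionRing (MvPolynomial (Fin 2) (ZMod 2))) a) = v₀ a)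
include hv hvK

/-- **Core.** Let `C ⊆ L = 𝔽₂(X₀,X₁)` be any `𝔽₂`-subalgebra inside the order-valuation ring `O`
whose elements are (images of) Euler constants — even polynomials — and which contains
`X₀², X₁², X₀X₁`. Then the local ring of `C` at the centre of `O` is NOT regular: `u = X₀²` lies in
`𝔪 ∖ 𝔪²` (orders: `𝔮 ≥ 2`, `𝔮² ≥ 4`, `u = 2`), so regularity would make `C_𝔮/(u)` regular
(Matsumura 14.2) hence a domain (14.3), but `w = X₀X₁` has `w² = u·X₁² ∈ (u)` and `w ∉ (u)`.
[folklore] -/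
theorem not_isRegularLocalRing_centre (C : Subalgebra (ZMod 2) (FractionRing (MvPolynomial (Fin 2) (ZMod 2))))
    (hC : C.toSubring ≤ v.valuationSubring.toSubring)
    (hCE : ∀ x ∈ C, ∃ a : (MvPolynomial (Fin 2) (ZMod 2)), algebraMap (MvPolynomial (Fin 2) (ZMod 2)) (FractionRing (MvPolynomial (Fin 2) (ZMod 2))) a = x ∧ X 0 * pderiv 0 a + X 1 * pderiv 1 a = 0)
    (hu : algebraMap (MvPolynomial (Fin 2) (ZMod 2)) (FractionRing (MvPolynomial (Fin 2) (ZMod 2))) (X 0 ^ 2) ∈ C) (hv' : algebraMap (MvPolynomial (Fin 2) (ZMod 2)) (FractionRing (MvPolynomial (Fin 2) (ZMod 2))) (X 1 ^ 2) ∈ C)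
    (hw : algebraMap (MvPolynomial (Fin 2) (ZMod 2)) (FractionRing (MvPolynomial (Fin 2) (ZMod 2))) (X 0 * X 1) ∈ C) :
    ¬ IsRegularLocalRing (Localization.AtPrime
      (Ideal.comap (Subring.inclusion hC) (maximalIdeal v.valuationSubring))) := by
  set O := v.valuationSubring with hO
  set 𝔮 : Ideal C.toSubring := Ideal.comap (Subring.inclusion hC) (maximalIdeal O) with h𝔮
  intro hreg
  -- valuation bookkeeping on `C`
  have mem_𝔮 : ∀ z : C.toSubring, z ∈ 𝔮 ↔ v (z : (FractionRing (MvPolynomial (Fin 2) (ZMod 2)))) < 1 := fun z => by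
    rw [h𝔮, Ideal.mem_comap]
    exact Valuation.mem_maximalIdeal_iff (v := v)
  have v_le_one : ∀ z : C.toSubring, v (z : (FractionRing (MvPolynomial (Fin 2) (ZMod 2)))) ≤ 1 := fun z =>
    (Valuation.mem_valuationSubring_iff v _).mp (hC z.2)
  have v_eq_one_of_not_mem : ∀ s : C.toSubring, s ∉ 𝔮 → v (s : (FractionRing (MvPolynomial (Fin 2) (ZMod 2)))) = 1 := fun s hs =>
    le_antisymm (v_le_one s) (not_lt.mp (mt (mem_𝔮 s).mpr hs))
  have v_le_of_mem : ∀ z : C.toSubring, z ∈ 𝔮 → v (z : (FractionRing (MvPolynomial (Fin 2) (ZMod 2)))) ≤ exp (-2) := by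
    intro z hz
    obtain ⟨a, ha, hEa⟩ := hCE z z.2
    have hz1 := (mem_𝔮 z).mp hz
    rw [← ha, hvK] at hz1 ⊢
    by_cases ha0 : a = 0
    · rw [ha0, map_zero]; exact zero_le
    have hc : constantCoeff a = 0 := by
      by_contra hc
      exact (ne_of_lt hz1) ((ordVal_eq_one_iff v₀ hv ha0).mpr hc)
    have h2 := two_le_ordN ha0 hc (fun m hm => coeff_eq_zero_of_euler_eq_zero hEa hm)
    rw [ordVal_of_ne_zero v₀ hv ha0, exp_le_exp]
    omega
  have v_sq : ∀ z : C.toSubring, z ∈ 𝔮 ^ 2 → v (z : (FractionRing (MvPolynomial (Fin 2) (ZMod 2)))) ≤ exp (-4) := by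
    intro z hz
    rw [pow_two] at hz
    refine Submodule.mul_induction_on hz ?_ ?_
    · intro m hm n hn
      rw [Subring.coe_mul, map_mul]
      calc v (m : (FractionRing (MvPolynomial (Fin 2) (ZMod 2)))) * v (n : (FractionRing (MvPolynomial (Fin 2) (ZMod 2)))) ≤ exp (-2) * exp (-2) :=
            mul_le_mul' (v_le_of_mem m hm) (v_le_of_mem n hn)
        _ = exp (-4) := by rw [← exp_add]; norm_num
    · intro x y hx hy
      rw [Subring.coe_add]
      exact (v.map_add (x : (FractionRing (MvPolynomial (Fin 2) (ZMod 2)))) (y : (FractionRing (MvPolynomial (Fin 2) (ZMod 2))))).trans (max_le hx hy)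
  -- the three elements `u = X₀²`, `v = X₁²`, `w = X₀X₁` of `C`, with `w² = u v`
  set uT : C.toSubring := ⟨algebraMap (MvPolynomial (Fin 2) (ZMod 2)) (FractionRing (MvPolynomial (Fin 2) (ZMod 2))) (X 0 ^ 2), hu⟩ with huT
  set vT : C.toSubring := ⟨algebraMap (MvPolynomial (Fin 2) (ZMod 2)) (FractionRing (MvPolynomial (Fin 2) (ZMod 2))) (X 1 ^ 2), hv'⟩ with hvT
  set wT : C.toSubring := ⟨algebraMap (MvPolynomial (Fin 2) (ZMod 2)) (FractionRing (MvPolynomial (Fin 2) (ZMod 2))) (X 0 * X 1), hw⟩ with hwT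
  have hwT2 : wT ^ 2 = uT * vT := by
    apply Subtype.ext
    change (algebraMap (MvPolynomial (Fin 2) (ZMod 2)) (FractionRing (MvPolynomial (Fin 2) (ZMod 2))) (X 0 * X 1)) ^ 2 =
      algebraMap (MvPolynomial (Fin 2) (ZMod 2)) (FractionRing (MvPolynomial (Fin 2) (ZMod 2))) (X 0 ^ 2) * algebraMap (MvPolynomial (Fin 2) (ZMod 2)) (FractionRing (MvPolynomial (Fin 2) (ZMod 2))) (X 1 ^ 2)
    rw [← map_pow, ← map_mul]
    congr 1
    ring
  have hvu : v (uT : (FractionRing (MvPolynomial (Fin 2) (ZMod 2)))) = exp (-2) := by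
    change v (algebraMap (MvPolynomial (Fin 2) (ZMod 2)) (FractionRing (MvPolynomial (Fin 2) (ZMod 2))) (X 0 ^ 2)) = exp (-2)
    rw [hvK, map_pow, ordVal_X v₀ hv, ← exp_nsmul]
    norm_num
  have hu𝔮 : uT ∈ 𝔮 := by
    rw [mem_𝔮, hvu, ← exp_zero, exp_lt_exp]
    norm_num
  -- `u ∈ 𝔪 ∖ 𝔪²`: `s u ∈ 𝔮²` with `s ∉ 𝔮` is impossible (orders `0 + 2` versus `≥ 4`)
  have hu2 : ∀ s ∉ 𝔮, s * uT ∉ 𝔮 ^ 2 := by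
    intro s hs𝔮 hs
    have h1 : v ((s * uT : C.toSubring) : (FractionRing (MvPolynomial (Fin 2) (ZMod 2)))) = exp (-2) := by
      rw [Subring.coe_mul, map_mul, hvu, v_eq_one_of_not_mem _ hs𝔮, one_mul]
    have h3 : v ((s * uT : C.toSubring) : (FractionRing (MvPolynomial (Fin 2) (ZMod 2)))) ≤ exp (-4) := v_sq _ hs
    rw [h1, exp_le_exp] at h3
    omega
  -- Matsumura 14.2 / 14.3 in the regular local ring `C_𝔮`: `a u = s w` for some `s ∉ 𝔮`
  haveI := hreg
  obtain ⟨s, hs𝔮, a, ha⟩ :=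
    exists_mul_eq_mul_of_isRegularLocalRing 𝔮 (Localization.AtPrime 𝔮) hwT2 hu𝔮 hu2
  -- read the identity `a X₀² = s X₀X₁` in `𝔽₂[X₀,X₁]`: it forces `s(0) = 0`, i.e. `s ∈ 𝔮`
  have hL : ((a : C.toSubring) : (FractionRing (MvPolynomial (Fin 2) (ZMod 2)))) * algebraMap (MvPolynomial (Fin 2) (ZMod 2)) (FractionRing (MvPolynomial (Fin 2) (ZMod 2))) (X 0 ^ 2) =
      ((s : C.toSubring) : (FractionRing (MvPolynomial (Fin 2) (ZMod 2)))) * algebraMap (MvPolynomial (Fin 2) (ZMod 2)) (FractionRing (MvPolynomial (Fin 2) (ZMod 2))) (X 0 * X 1) := by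
    have := congrArg Subtype.val ha
    simpa only [Subring.coe_mul] using this
  obtain ⟨a', ha', -⟩ := hCE a a.2
  obtain ⟨s', hs', -⟩ := hCE s s.2
  rw [← ha', ← hs', ← map_mul, ← map_mul] at hL
  have hA : X 0 * X 1 * s' = a' * X 0 ^ 2 := by
    rw [(IsFractionRing.injective (MvPolynomial (Fin 2) (ZMod 2)) (FractionRing (MvPolynomial (Fin 2) (ZMod 2)))) hL]
    ring
  have hc : constantCoeff s' = 0 := constantCoeff_eq_zero_of_mul_eq hA
  have hvs : v ((s : C.toSubring) : (FractionRing (MvPolynomial (Fin 2) (ZMod 2)))) = 1 := v_eq_one_of_not_mem _ hs𝔮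
  rw [← hs', hvK] at hvs
  have hs0 : s' ≠ 0 := by
    rintro rfl
    rw [map_zero] at hvs
    exact zero_ne_one hvs
  exact ((ordVal_eq_one_iff v₀ hv hs0).mp hvs) hc

end Core

end DualSandwichNaiveDescentNeg

open DualSandwichNaiveDescentNeg in
/-- **Naive descent is FALSE: the trace of a regular model below a height-one Frobenius sandwich
need not be regular at the centre.** The negated statement is the natural strengthening of the
descent step of crux `DualSandwich` (line `birth`: `RelStep p`) in which the regular model of the
bottom field is required to be the TRACE `C = B ∩ F` of the given regular model `B` of the top
field (no modification): for `k` perfect of characteristic `p`, `F ⊆ L` an intermediate field with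
`L ^ p ⊆ F` and `L = F(y)` (purely inseparable, height one, simple), `O` a valuation ring of `L`,
`B ⊆ O` finitely generated with `Frac B = L` and regular at the centre of `O`, and `C ⊆ O` the
subalgebra `B ∩ F`, the local ring of `C` at the centre of `O` would be regular. Witness: `p = 2`,
`k = 𝔽₂`, `L = 𝔽₂(X₀,X₁)`, `B = 𝔽₂[X₀,X₁]`, `O` = order at the origin, `F = ker (X₀∂₀ + X₁∂₁)`
(`= 𝔽₂(X₀², X₀X₁)`, `L = F(X₀)`), `C = 𝔽₂[X₀², X₀X₁, X₁²]`, the `A₁` / `μ₂`-quotient point — not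
regular (`not_isRegularLocalRing_centre`). Moral for provers of `DualSandwich`: each degree-`p`
descent consumes a genuine modification of the bottom model (`FolLU` + `LogCanQuotLU` in
`stub_relStep`); `A := B.comap _` is available only when `K = L`. [folklore] -/
theorem naiveDescent_false : ¬ (∀ p : ℕ, p.Prime → ∀ (k L : Type) [Field k] [CharP k p]
    [PerfectField k] [Field L] [Algebra k L] (F : IntermediateField k L),
    (∀ x : L, x ^ p ∈ F) → (∃ y : L, ∀ x : L, x ∈ IntermediateField.adjoin F {y}) →
    ∀ (O : ValuationSubring L) (B : Subalgebra k L) (hB : B.toSubring ≤ O.toSubring),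
    B.FG → IsFractionRing B L →
    IsRegularLocalRing (Localization.AtPrime (Ideal.comap (Subring.inclusion hB)
      (IsLocalRing.maximalIdeal O))) →
    ∀ (C : Subalgebra k L) (hC : C.toSubring ≤ O.toSubring), (∀ x : L, x ∈ C ↔ x ∈ B ∧ x ∈ F) →
    IsRegularLocalRing (Localization.AtPrime (Ideal.comap (Subring.inclusion hC)
      (IsLocalRing.maximalIdeal O)))) := by
  intro h
  obtain ⟨v₀, hv⟩ := exists_ordVal
  obtain ⟨v, hvK⟩ := exists_extension v₀ hv
  obtain ⟨E, hE⟩ := exists_euler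
  haveI := charP_frac
  set A := MvPolynomial (Fin 2) (ZMod 2) with hA
  set L := FractionRing (MvPolynomial (Fin 2) (ZMod 2)) with hL
  set O : ValuationSubring L := v.valuationSubring with hO
  set B : Subalgebra (ZMod 2) L := (IsScalarTower.toAlgHom (ZMod 2) A L).range with hBdef
  have mem_B : ∀ {z : L}, z ∈ B ↔ ∃ a : A, algebraMap A L a = z := AlgHom.mem_range _
  have algebraMap_mem_B : ∀ a : A, algebraMap A L a ∈ B := fun a => mem_B.mpr ⟨a, rfl⟩
  -- the bottom field `F = ker E`
  let F : IntermediateField (ZMod 2) L :=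
    { carrier := {x | E x = 0}
      mul_mem' := fun {a b} ha hb => by
        simp only [Set.mem_setOf_eq] at ha hb ⊢
        rw [Derivation.leibniz, ha, hb, smul_zero, smul_zero, add_zero]
      one_mem' := by
        simp only [Set.mem_setOf_eq]
        exact E.map_one_eq_zero
      add_mem' := fun {a b} ha hb => by
        simp only [Set.mem_setOf_eq] at ha hb ⊢
        rw [map_add, ha, hb, add_zero]
      zero_mem' := by
        simp only [Set.mem_setOf_eq]
        exact map_zero E
      algebraMap_mem' := fun c => by
        simp only [Set.mem_setOf_eq]
        exact E.map_algebraMap c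
      inv_mem' := fun x hx => by
        change E x = 0 at hx
        change E x⁻¹ = 0
        rw [Derivation.leibniz_inv, hx, smul_zero] }
  have mem_F : ∀ {x : L}, x ∈ F ↔ E x = 0 := Iff.rfl
  have hEalg : ∀ a : A, E (algebraMap A L a) = 0 ↔ X 0 * pderiv 0 a + X 1 * pderiv 1 a = 0 := by
    intro a
    rw [hE]
    constructor
    · intro h0
      exact (IsFractionRing.injective A L) (by rw [h0, map_zero])
    · intro h0
      rw [h0, map_zero]
  -- `L² ⊆ F` (height one)
  have hsq : ∀ x : L, x ^ 2 ∈ F := fun x => by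
    rw [mem_F, Derivation.leibniz_pow, two_nsmul, CharTwo.add_self_eq_zero]
  -- `L = F(X₀)` (simple): `X₀X₁ ∈ F`, so `X₁ = (X₀X₁)/X₀ ∈ F(X₀)`
  have hwF : algebraMap A L (X 0 * X 1) ∈ F := by
    rw [mem_F, hEalg]
    exact euler_X0_mul_X1
  have hX0 : algebraMap A L (X 0) ≠ 0 := fun h0 =>
    X_ne_zero (0 : Fin 2) ((IsFractionRing.injective A L) (by rw [h0, map_zero]))
  have hsimple : ∃ y : L, ∀ x : L, x ∈ IntermediateField.adjoin F {y} := by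
    refine ⟨algebraMap A L (X 0), fun x => ?_⟩
    set M := IntermediateField.adjoin F {algebraMap A L (X 0)} with hM
    have hx0 : algebraMap A L (X 0) ∈ M := IntermediateField.mem_adjoin_simple_self F _
    have hw : algebraMap A L (X 0 * X 1) ∈ M :=
      M.algebraMap_mem (⟨algebraMap A L (X 0 * X 1), hwF⟩ : F)
    have hx1 : algebraMap A L (X 1) ∈ M := by
      have e : algebraMap A L (X 1) = algebraMap A L (X 0 * X 1) * (algebraMap A L (X 0))⁻¹ := by
        rw [map_mul, mul_comm (algebraMap A L (X 0)), mul_assoc, mul_inv_cancel₀ hX0, mul_one]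
      rw [e]
      exact M.mul_mem hw (M.inv_mem hx0)
    have hX : ∀ i : Fin 2, algebraMap A L (X i) ∈ M := fun i => by
      fin_cases i
      · exact hx0
      · exact hx1
    have hpoly : ∀ a : A, algebraMap A L a ∈ M := fun a => by
      induction a using MvPolynomial.induction_on with
      | C c =>
        have e : algebraMap A L (MvPolynomial.C c) = algebraMap F L (algebraMap (ZMod 2) F c) := by
          rw [← IsScalarTower.algebraMap_apply (ZMod 2) F L,
            IsScalarTower.algebraMap_apply (ZMod 2) A L, MvPolynomial.algebraMap_eq]
        rw [e]
        exact M.algebraMap_mem _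
      | add p q hp hq =>
        rw [map_add]
        exact M.add_mem hp hq
      | mul_X p i hp =>
        rw [map_mul]
        exact M.mul_mem hp (hX i)
    obtain ⟨a, b, -, rfl⟩ := IsFractionRing.div_surjective (A := A) x
    exact M.div_mem (hpoly a) (hpoly b)
  -- the regular top `B = 𝔽₂[X₀,X₁]`
  have hB : B.toSubring ≤ O.toSubring := by
    intro z hz
    obtain ⟨a, rfl⟩ := mem_B.mp hz
    change algebraMap A L a ∈ v.valuationSubring
    rw [Valuation.mem_valuationSubring_iff, hvK]
    exact ordVal_le_one v₀ hv a
  have hreg : IsRegularLocalRing (Localization.AtPrime (Ideal.comap (Subring.inclusion hB)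
      (IsLocalRing.maximalIdeal O))) := by
    haveI : IsRegularRing B.toSubring := isRegularRing_range
    infer_instance
  -- the trace `C = B ∩ F`
  set C : Subalgebra (ZMod 2) L := B ⊓ F.toSubalgebra with hCdef
  have mem_C : ∀ x : L, x ∈ C ↔ x ∈ B ∧ x ∈ F := fun x => Iff.rfl
  have hC : C.toSubring ≤ O.toSubring := fun x hx => hB ((mem_C x).mp hx).1
  have hbad := h 2 Nat.prime_two (ZMod 2) L F hsq hsimple O B hB range_fg isFractionRing_range
    hreg C hC mem_C
  refine not_isRegularLocalRing_centre v₀ hv v hvK C hC ?_ ?_ ?_ ?_ hbad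
  · intro x hx
    obtain ⟨hxB, hxF⟩ := (mem_C x).mp hx
    obtain ⟨a, rfl⟩ := mem_B.mp hxB
    exact ⟨a, rfl, (hEalg a).mp hxF⟩
  · exact (mem_C _).mpr ⟨algebraMap_mem_B _, by rw [map_pow]; exact hsq _⟩
  · exact (mem_C _).mpr ⟨algebraMap_mem_B _, by rw [map_pow]; exact hsq _⟩
  · exact (mem_C _).mpr ⟨algebraMap_mem_B _, hwF⟩

end

end Summit.ResolutionOfSingularities.ResolutionOfSingularities.Theorems
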